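import Mathlib
import Literature.NumberTheory.Transcendental.GelfondSchneiderProofs
import Literature.NumberTheory.Transcendental.LindemannWeierstrassProofs
import Literature.NumberTheory.Transcendental.BakerLogarithmsConclusion
import Literature.NumberTheory.Transcendental.RoyCriterion
import Summits.Schanuel.Schanuel.Theses.RootDecomp1B
import HarnessLib

/-!
# `RootDecomp1BTranscendencePackageFloor` — part 01 of 05 (`RootDecomp1BTranscendencePackageFloor01`): §7 — the Schanuel-type statements polymorphic in the exponential `E` (`KleinPolarE`, `LocalSurplusBudgetE`, `TameDefectZeroStepE`, `SchanuelRankE`, `SchanuelE`, `HermiteLindemannE`, `LindemannWeierstrassE`, `GelfondSchneiderE`, `BakerE`), the structures `IsInvolutiveExp`, `AgreesOnQbar`, and the `Iff.rfl` DICTIONARY to the route items / `SchanuelRank` / `Schanuel`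

PORT in five parts (≤ 400 lines each, shared namespace `Summit.Schanuel.Schanuel.Theorems.RootDecomp1BTranscendencePackageFloor`, each part importing the previous; `--supports stmt-Schanuel-24622`) of the decomp-schanuel lens-4 kernel file `HOME/decomp-schanuel-lens-4/g16/TwistFloor.lean` (gen 16, sha256 fb39e438…, 1054 lines, rc 0) as prepared by lens-4 gen 17 (`HOME/decomp-schanuel-lens-4/g17/port/`); statements and proofs verbatim up to the namespace, the docstrings and three added discontinuity lemmas. Overview of the whole port:

# `KleinPolarSchanuel` (crux `stmt-Schanuel-24622`) and the storey-0 items of route RootDecomp1B are FALSE WITHOUT a property of `exp` beyond the algebraic-point transcendence package — the sheared exponential `E₀` (TRANSCENDENCE PACKAGE FLOOR)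

Negative-side certificate (`_false_without_` form) for the crux `KleinPolarSchanuel` of route
`Summits/Schanuel/Schanuel/Theses/RootDecomp1B.lean` and its storey-0 companions
`LocalSurplusBudget`, `TameDefectZeroStep` (decomp-schanuel programme, lens «minimal counterexample /
extremal reduction», generations 16–17, 2026-08-30; `--supports stmt-Schanuel-24622`). Nothing
here proves or refutes a route item: the file exhibits an exponential `E₀` ON `ℂ` ITSELF which
satisfies every property of `exp` in the ALGEBRAIC-POINT TRANSCENDENCE PACKAGE below and for which
the `E₀`-analogues of `KleinPolarSchanuel` (length `1`), `LocalSurplusBudget` (length `1`),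
`TameDefectZeroStep` (storey `0`), `SchanuelRank 2` and the summit `Schanuel` all FAIL. Hence any
proof of these items must use a property of `exp` OUTSIDE the package (order / continuity /
analyticity at transcendental arguments). Sorry-free, standard axioms, no named fact consumed or
introduced.

## What is constructed (namespace `Summit.Schanuel.Schanuel.Theorems.RootDecomp1BTranscendencePackageFloor`)

Let `A = ℚ̄ ∩ ℝ` (`A`), `ℓ₀ = log 2`, `w₀ = 2^i = e^{iℓ₀}`, `u₀ = 2 cos ℓ₀ = 2^i + 2^{-i}` (`ℓ₀`,
`u₀`, `w₀`; `ℓ₀` is transcendental by Hermite–Lindemann, `w₀` by Gelfond–Schneider, hence `u₀`,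
and `1, u₀` are `A`-linearly independent). Linear algebra over the field `A` gives an `A`-linear
functional `φ : ℝ → A` with `φ 1 = 0`, `φ u₀ = 1`, `φ ℓ₀ ≠ 0` (`exists_phi`). A SHEAR
(`structure Shear`: such a `φ` with marked points `u`, `ℓ`) defines
`θ z = z + (φ(Re z) + i φ(Im z))·(ℓ − u)` (`Shear.θ`) — a `ℚ̄`-linear, `conj`-equivariant
bijection of `ℂ` fixing `ℚ̄` pointwise, mapping `ℝ` onto `ℝ` and `iℝ` onto `iℝ`, with `θ u = ℓ`,
`θ(iu) = iℓ` — and the SHEARED EXPONENTIAL `E = exp ∘ θ` (`Shear.E`). The model is `E₀ = exp ∘ θ₀`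
for the shear `S₀ = (φ₀, u₀, ℓ₀)` (`E₀`), so that `E₀ u₀ = 2` and `E₀ (iu₀) = 2^i`.

## What is proved

* `transcendencePackage_E₀`: `E₀` satisfies `TranscendencePackage E` = (E1) `IsInvolutiveExp E` —
  a `conj`-equivariant homomorphism `(ℂ,+) → (ℂˣ,·)` onto `ℂˣ` with cyclic kernel `ℤτ`,
  `conj τ = −τ`, standard torsion `E(τ/n) = e^{2πi/n}`, polar dictionary `E(ℝ) = ℝ_{>0}`,
  `E(iℝ) = S¹`; (E2) `AgreesOnQbar E` — `E = exp` on `ℚ̄`, `E = exp ∘ θ` for a `ℚ̄`-linear bijection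
  `θ` with `θ 1 = 1`; (E3) LINDEMANN–WEIERSTRASS, HERMITE–LINDEMANN, GELFOND–SCHNEIDER and BAKER
  verbatim for `E` (the texts of the tree facts `algebraicIndependent_exp`, `transcendental_exp`,
  `gelfond_schneider`, `baker` with `cexp` replaced by `E`; transferred for `E = S.E` from the tree's
  discharged `_holds` theorems); (E4) Schanuel in rank one for `E` (from HL).
* `transcendencePackage_exp`: `exp` satisfies the package.
* DICTIONARY (all `Iff.rfl`): `KleinPolarE cexp ↔ Theses.RootDecomp1B.KleinPolarSchanuel`,
  `LocalSurplusBudgetE cexp ↔ .LocalSurplusBudget`, `TameDefectZeroStepE cexp ↔ .TameDefectZeroStep`,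
  `SchanuelRankE cexp l ↔ Literature.NumberTheory.Transcendental.SchanuelRank l`,
  `SchanuelE cexp ↔ Schanuel`.
* VERDICTS in the model: `not_kleinPolarE_E₀`, `not_localSurplusBudgetE_E₀`,
  `not_tameDefectZeroStepE_E₀`, `not_schanuelRankE_E₀_two`, `not_schanuelE_E₀` (at the `ℚ`-free,
  `conj`-stable polar pair `(u₀, iu₀)`: `ℚ(u₀, iu₀, E₀u₀, E₀(iu₀)) = ℚ(u₀, iu₀, 2, 2^i)` is algebraic
  over `K₀ = ℚ(2^i)`, transcendence degree `≤ 1 < 2`), with `schanuelRankE_E₀_one` a FIRST failure;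
  packaged as `twistFloor`; and what the package does not see: `not_continuous_E₀_real`,
  `not_continuous_E₀`, `E₀_u₀_ne_exp`.
* HEADLINE (namespace `…RootDecomp1BTranscendencePackageFloor`): `kleinPolarSchanuel_false_without_extra_channel`
  (`¬ ∀ E, TranscendencePackage E → KleinPolarE E`), its companions for `LocalSurplusBudgetE`,
  `TameDefectZeroStepE`, `SchanuelRankE · 2`, `SchanuelE`, the existence statement
  `transcendencePackageFloor`, and `transcendencePackage_exp_dictionary` (the package holds for
  `exp`, whose instances of the five statements are the route items / `SchanuelRank 2` / `Schanuel`).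

## Reading

Any proof of `KleinPolarSchanuel`, `LocalSurplusBudget` at length `1`, `TameDefectZeroStep` at
storey `0`, or of `SchanuelRank 2` at a polar pair must use a property of `exp` OUTSIDE (E1)–(E4).
What separates `exp` from `E₀` is ORDER / CONTINUITY / ANALYTICITY at TRANSCENDENTAL arguments
(`not_continuous_E₀_real`): the kernel form, on `ℂ` itself, of the cell's verdict "storey 0 needs a
second channel".

## Design

* Everything is over Mathlib; transcendence inputs are the tree's DISCHARGED facts
  (`Literature/NumberTheory/Transcendental/{LindemannWeierstrassProofs, GelfondSchneiderProofs,
  BakerLogarithmsConclusion}.lean`); the §5 transcendence-degree lemmas are private copies of tree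
  folklore (`Literature.Barriers.Schanuel.one_le_trdeg_of_transcendental_mem`,
  `Literature.Barriers.Schanuel.trdeg_adjoin_singleton_le_one`,
  `Literature.NumberTheory.Transcendental.PrasadRapinchuk.trdeg_adjoin_le_of_isAlgebraic`), whose home
  modules are not imported to keep the import cone small.
* No closed `Prop` definition is introduced (no conjecture, no named fact); `TranscendencePackage`,
  `KleinPolarE`, … are predicates in the exponential `E`.
* `(ℂ, E₀)` is an exponential field in the sense of [Kirby2010EAEF, Definition 2.1]; nearest
  catalogued barrier: `Literature/Barriers/Schanuel/AxiomsDoNotForceSchanuel.lean`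
  [BaysKirby2018ANT, §9.2] (abstract models `𝔹_P`, Zilber's axioms, conditional) — complementary.

## Not claimed

`τ = θ₀⁻¹(2πi)` is not identified with `2πi`; six exponentials, Nesterenko, Baker–Wüstholz, Roy's
criterion, exponential-algebraic closedness are asserted neither for nor against `E₀`; no route item
is closed or refuted by this file.
-/

noncomputable section

open Complex

set_option linter.dupNamespace false

namespace Summit.Schanuel.Schanuel.Theorems.RootDecomp1BTranscendencePackageFloor

/-! ## §7 Schanuel-type statements, polymorphic in the exponential, and the dictionary to the tree -/

/-- Klein-polar Schanuel with `E` for `exp`: for `ℚ`-free reals `r₁, …, r_m`,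
`trdeg_ℚ ℚ(r, ir, E r, E(ir)) ≥ 2m`. The text of the crux `KleinPolarSchanuel` of route
`Summits/Schanuel/Schanuel/Theses/RootDecomp1B.lean` with `Complex.exp` replaced by `E` (at
`E = cexp` the two agree by `Iff.rfl`: `kleinPolarE_exp_iff`). [folklore] -/
def KleinPolarE (E : ℂ → ℂ) : Prop :=
  ∀ (m : ℕ) (r : Fin m → ℝ), LinearIndependent ℚ r → ((m + m : ℕ) : Cardinal) ≤ Algebra.trdeg ℚ ↥(IntermediateField.adjoin ℚ (Set.range (Fin.append (fun j => ((r j : ℝ) : ℂ)) (fun j => ((r j : ℝ) : ℂ) * Complex.I)) ∪ Set.range (E ∘ Fin.append (fun j => ((r j : ℝ) : ℂ)) (fun j => ((r j : ℝ) : ℂ) * Complex.I))))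

/-- The Local Surplus Budget with `E` for `exp`: under Klein-polar Schanuel for `E` below
length `m`, `2m + trdeg ℚ(r) ≤ trdeg ℚ(r, E r) + trdeg ℚ(ir, E(ir))` for `ℚ`-free real `r` of
length `m`. The text of the item `LocalSurplusBudget` of route RootDecomp1B with `Complex.exp`
replaced by `E` (agreement at `E = cexp` by `Iff.rfl`: `localSurplusBudgetE_exp_iff`). [folklore] -/
def LocalSurplusBudgetE (E : ℂ → ℂ) : Prop :=
  ∀ (m : ℕ) (r : Fin m → ℝ), LinearIndependent ℚ r → (∀ k, k < m → ∀ (s : Fin k → ℝ), LinearIndependent ℚ s → ((k + k : ℕ) : Cardinal) ≤ Algebra.trdeg ℚ ↥(IntermediateField.adjoin ℚ (Set.range (Fin.append (fun j => ((s j : ℝ) : ℂ)) (fun j => ((s j : ℝ) : ℂ) * Complex.I)) ∪ Set.range (E ∘ Fin.append (fun j => ((s j : ℝ) : ℂ)) (fun j => ((s j : ℝ) : ℂ) * Complex.I))))) → ((m + m : ℕ) : Cardinal) + Algebra.trdeg ℚ ↥(IntermediateField.adjoin ℚ (Set.range (fun j => ((r j : ℝ) : ℂ)))) ≤ Algebra.trdeg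 ℚ ↥(IntermediateField.adjoin ℚ (Set.range (fun j => ((r j : ℝ) : ℂ)) ∪ Set.range (E ∘ fun j => ((r j : ℝ) : ℂ)))) + Algebra.trdeg ℚ ↥(IntermediateField.adjoin ℚ (Set.range (fun j => ((r j : ℝ) : ℂ) * Complex.I) ∪ Set.range (E ∘ fun j => ((r j : ℝ) : ℂ) * Complex.I)))

/-- The tame defect-zero step with `E` for `exp`: the inductive step of Klein-polar Schanuel
for `E` at a TAME new coordinate (one adjoining at most one new transcendental among
`E r_m, E(i r_m)` over `ℚ(r)`), from the initial bound `2m + 1`. The text of the item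
`TameDefectZeroStep` of route RootDecomp1B with `Complex.exp` replaced by `E` (agreement at
`E = cexp` by `Iff.rfl`: `tameDefectZeroStepE_exp_iff`). [folklore] -/
def TameDefectZeroStepE (E : ℂ → ℂ) : Prop :=
  ∀ (m : ℕ) (r : Fin (m + 1) → ℝ), LinearIndependent ℚ r → (∀ k, k < m + 1 → ∀ (s : Fin k → ℝ), LinearIndependent ℚ s → ((k + k : ℕ) : Cardinal) ≤ Algebra.trdeg ℚ ↥(IntermediateField.adjoin ℚ (Set.range (Fin.append (fun j => ((s j : ℝ) : ℂ)) (fun j => ((s j : ℝ) : ℂ) * Complex.I)) ∪ Set.range (E ∘ Fin.append (fun j => ((s j : ℝ) : ℂ)) (fun j => ((s j : ℝ) : ℂ) * Complex.I))))) → Algebra.trdeg ℚ ↥(IntermediateField.adjoin ℚ (Set.range (fun j => ((r j : ℝ) : ℂ)) ∪ {E ((r (Fin.last m) : ℝ) : ℂ), E (((r (Fin.last m) : ℝ) : ℂ) * Complex.I)})) ≤ Algebra.trdeg ℚ ↥(IntermediateField.adjoin ℚ (Set.range (fun j => ((r j : ℝ) : ℂ)))) + 1 → ((m + m + 1 : ℕ)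 : Cardinal) ≤ Algebra.trdeg ℚ ↥(IntermediateField.adjoin ℚ (Set.range (Fin.append (fun j => ((r j : ℝ) : ℂ)) (fun j => ((r j : ℝ) : ℂ) * Complex.I)) ∪ Set.range (E ∘ Fin.append (fun j => ((r j : ℝ) : ℂ)) (fun j => ((r j : ℝ) : ℂ) * Complex.I)))) → ((m + 1 + (m + 1) : ℕ) : Cardinal) ≤ Algebra.trdeg ℚ ↥(IntermediateField.adjoin ℚ (Set.range (Fin.append (fun j => ((r j : ℝ) : ℂ)) (fun j => ((r j : ℝ) : ℂ) * Complex.I)) ∪ Set.range (E ∘ Fin.append (fun j => ((r j : ℝ) : ℂ)) (fun j => ((r j : ℝ) : ℂ) * Complex.I))))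

/-- Schanuel in rank `l` with `E` for `exp`: for `ℚ`-free `y₁, …, y_l`,
`trdeg_ℚ ℚ(y, E y) ≥ l` — the text of `Literature.NumberTheory.Transcendental.SchanuelRank l` with
`cexp` replaced by `E` (`schanuelRankE_exp_iff`); the length-`l` case of the SCHANUEL PROPERTY of the
exponential field `(ℂ, E)` (Kirby 2010, §1: `δ(x̄) = td(x̄, E x̄) − ldim_ℚ x̄ ≥ 0`).
[cite: Kirby2010EAEF, §1 (Schanuel property), tuples of length l] -/
def SchanuelRankE (E : ℂ → ℂ) (l : ℕ) : Prop :=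
  ∀ (y : Fin l → ℂ), LinearIndependent ℚ y →
    (l : Cardinal) ≤ Algebra.trdeg ℚ
      ↥(IntermediateField.adjoin ℚ (Set.range y ∪ Set.range (E ∘ y)))

/-- The SCHANUEL PROPERTY of the exponential field `(ℂ, E)` (Kirby 2010, §1: `δ(x̄) ≥ 0` for
every tuple, `δ(x̄) = td(x̄, E x̄) − ldim_ℚ x̄`), in the tree's phrasing: the text of the summit
statement `Schanuel` with `cexp` replaced by `E` (`schanuelE_exp_iff`).
[cite: Kirby2010EAEF, §1 (Schanuel property)] -/
def SchanuelE (E : ℂ → ℂ) : Prop :=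
  ∀ (n : ℕ) (z : Fin n → ℂ), LinearIndependent ℚ z →
    (n : Cardinal) ≤ Algebra.trdeg ℚ
      ↥(IntermediateField.adjoin ℚ (Set.range z ∪ Set.range (E ∘ z)))

/-- DICTIONARY: at `E = exp`, `KleinPolarE cexp` IS the route's crux `KleinPolarSchanuel`
(stmt-Schanuel-24622), by `Iff.rfl`. [folklore] -/
theorem kleinPolarE_exp_iff :
    KleinPolarE cexp ↔ Summit.Schanuel.Schanuel.Theses.RootDecomp1B.KleinPolarSchanuel := Iff.rfl

/-- DICTIONARY: `LocalSurplusBudgetE cexp` IS the route's `LocalSurplusBudget` (`Iff.rfl`). [folklore] -/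
theorem localSurplusBudgetE_exp_iff :
    LocalSurplusBudgetE cexp ↔ Summit.Schanuel.Schanuel.Theses.RootDecomp1B.LocalSurplusBudget :=
  Iff.rfl

/-- DICTIONARY: `TameDefectZeroStepE cexp` IS the route's `TameDefectZeroStep` (`Iff.rfl`). [folklore] -/
theorem tameDefectZeroStepE_exp_iff :
    TameDefectZeroStepE cexp ↔ Summit.Schanuel.Schanuel.Theses.RootDecomp1B.TameDefectZeroStep :=
  Iff.rfl

/-- DICTIONARY, rank `l`: `SchanuelRankE cexp l` IS the tree's
`Literature.NumberTheory.Transcendental.SchanuelRank l` (`Iff.rfl`). [cite: Roy2001, §1] -/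
theorem schanuelRankE_exp_iff (l : ℕ) :
    SchanuelRankE cexp l ↔ Literature.NumberTheory.Transcendental.SchanuelRank l := Iff.rfl

/-- DICTIONARY, summit: `SchanuelE cexp` IS the summit `Schanuel` (`Iff.rfl`).
[cite: Waldschmidt2000, §1.4] -/
theorem schanuelE_exp_iff : SchanuelE cexp ↔ Schanuel := Iff.rfl

/-- Hermite–Lindemann for an exponential `E`: `E α` is transcendental for algebraic `α ≠ 0` —
the text of the tree fact `Literature.NumberTheory.Transcendental.transcendental_exp` with `cexp`
replaced by `E`. [cite: Lindemann1882] -/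
def HermiteLindemannE (E : ℂ → ℂ) : Prop :=
  ∀ {α : ℂ}, IsAlgebraic ℚ α → α ≠ 0 → Transcendental ℚ (E α)

/-- Lindemann–Weierstrass for an exponential `E`: `E α₁, …` are algebraically independent for
`ℚ`-free algebraic `αᵢ` — the text of the tree fact
`Literature.NumberTheory.Transcendental.algebraicIndependent_exp` (index types in `Type`) with
`cexp` replaced by `E`. [cite: Weierstrass1885] -/
def LindemannWeierstrassE (E : ℂ → ℂ) : Prop :=
  ∀ {ι : Type} (α : ι → ℂ), (∀ i, IsAlgebraic ℚ (α i)) → LinearIndependent ℚ α →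
    AlgebraicIndependent ℚ fun i => E (α i)

/-- Gelfond–Schneider for an exponential `E`: `E (b l)` is transcendental when `E l = a` is
algebraic, `l ≠ 0`, `b` algebraic irrational — the text of the tree fact
`Literature.NumberTheory.Transcendental.gelfond_schneider` with `cexp` replaced by `E`.
[cite: Gelfond1934] -/
def GelfondSchneiderE (E : ℂ → ℂ) : Prop :=
  ∀ {a b l : ℂ}, IsAlgebraic ℚ a → IsAlgebraic ℚ b → b ∉ Set.range ((↑) : ℚ → ℂ) → E l = a →
    l ≠ 0 → Transcendental ℚ (E (b * l))

/-- Baker's theorem (homogeneous with `1`, qualitative) for an exponential `E`: `ℚ`-free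
`E`-logarithms of algebraic numbers are `ℚ̄`-free together with `1` — the text of the tree fact
`Literature.NumberTheory.Transcendental.baker` (index types in `Type`) with `cexp` replaced by `E`.
[cite: Baker1966, 68] -/
def BakerE (E : ℂ → ℂ) : Prop :=
  ∀ {ι : Type} (l : ι → ℂ), (∀ i, IsAlgebraic ℚ (E (l i))) → LinearIndependent ℚ l →
    LinearIndependent (algebraicClosure ℚ ℂ) fun o : Option ι => o.elim 1 l

/-- The axioms of an exponential on `(ℂ, +, ·, conj, ℝ)`: surjective homomorphism onto `ℂˣ` with
cyclic kernel `ℤτ`, `conj τ = -τ`, standard torsion `E(τ/n) = e^{2πi/n}`, `conj`-equivariant, and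
the POLAR DICTIONARY `E(ℝ) = ℝ_{>0}`, `E(iℝ) = S¹`. In particular `(ℂ, E)` is an exponential
field ("a field of characteristic zero equipped with a homomorphism from `𝔾_a` to `𝔾_m`").
[cite: Kirby2010EAEF, Definition 2.1] -/
structure IsInvolutiveExp (E : ℂ → ℂ) : Prop where
  /-- `E` is a homomorphism `(ℂ, +) → (ℂ, ·)` -/
  map_add : ∀ z w, E (z + w) = E z * E w
  /-- onto `ℂˣ` -/
  surj : ∀ w : ℂ, w ≠ 0 → ∃ z, E z = w
  /-- cyclic kernel `ℤτ` with `conj τ = -τ` and standard torsion `E (τ/n) = e^{2πi/n}` -/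
  kernel : ∃ τ : ℂ, τ ≠ 0 ∧ (starRingEnd ℂ) τ = -τ ∧ (∀ z, E z = 1 ↔ ∃ n : ℤ, z = n * τ) ∧
    ∀ n : ℕ, E (τ / n) = cexp (2 * Real.pi * I / n)
  /-- `conj`-equivariance -/
  map_conj : ∀ z, E ((starRingEnd ℂ) z) = (starRingEnd ℂ) (E z)
  /-- `E(ℝ) ⊆ ℝ_{>0}` -/
  real_pos : ∀ x : ℝ, ∃ t : ℝ, 0 < t ∧ E x = t
  /-- `E : ℝ → ℝ_{>0}` is onto -/
  real_onto : ∀ t : ℝ, 0 < t → ∃ x : ℝ, E x = t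
  /-- `E(iℝ) ⊆ S¹` -/
  imag_circle : ∀ y : ℝ, ‖E ((y : ℂ) * I)‖ = 1
  /-- `E : iℝ → S¹` is onto -/
  imag_onto : ∀ w : ℂ, ‖w‖ = 1 → ∃ y : ℝ, E ((y : ℂ) * I) = w

/-- Agreement with `exp` on `ℚ̄` and `ℚ̄`-linear transport of logarithms: `E = exp ∘ θ` for a
`ℚ̄`-linear bijection `θ` fixing `1` (hence fixing `ℚ̄` pointwise). [folklore] -/
structure AgreesOnQbar (E : ℂ → ℂ) : Prop where
  /-- `E = exp` at every algebraic point -/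
  eq_exp : ∀ q : ℂ, IsAlgebraic ℚ q → E q = cexp q
  /-- `E = exp ∘ θ` for an additive `ℚ̄`-linear bijection `θ` with `θ 1 = 1` -/
  transport : ∃ θ : ℂ → ℂ, Function.Bijective θ ∧ θ 1 = 1 ∧
    (∀ q z : ℂ, IsAlgebraic ℚ q → θ (q * z) = q * θ z) ∧ (∀ z w, θ (z + w) = θ z + θ w) ∧
    ∀ z, E z = cexp (θ z)

end Summit.Schanuel.Schanuel.Theorems.RootDecomp1BTranscendencePackageFloor

end
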